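import Summits.HodgeConjecture.HodgeConjecture.Theses.EndoscopicMiddleDegree

/-!
# `MiddleThetaSpan` is false modulo an ε-negative GL₂-CAP witness (negative lemma, m = 1)

Crux `stmt-HodgeConjecture-13661` = `EndoscopicMiddleDegree.MiddleThetaSpan` (route
`route-HodgeConjecture-EndoscopicMiddleDegree`, rank 2): for `m ∈ {1,2}` every RATIONAL Hodge
`(m+1,m+1)`-class on a compact arithmetic `2(m+1)`-ball quotient `X(ℂ) ≅ Γ\𝔹` (datum `D`) lies in
`SC^{m+1}(D) ⊔ span{s ∪ d : s ∈ SC^m(D), d ∈ N¹H²} ⊔ span{a ∪ d : a ∈ Hdg^{m,m}_ℚ, d ∈ N¹H²}`.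

This file lands the formal hook `MiddleThetaSpan_false_of_epsNegativeCapWitness :
EpsNegativeCapWitness → ¬ MiddleThetaSpan`, where the hypothesis `EpsNegativeCapWitness` (an object the
tree cannot construct today: it needs an inhabited `UnitaryBallQuotientDatum 4 X`) is the typed shadow
of the candidate SUBSTANTIVE counterexample found by crux-triage r1-3 (Panel note 1,
`Cruxes/MiddleThetaSpan/KillPatternEpsNegativeCAP.md`, 2026-08-16) and confirmed on paper by the line
lead (prover-line-stmt-HodgeConjecture-13661-0, PICKED line `conjugate-dimension-sieve`, whose theta
stub `stub_singletonSpan` it kills together with the theta stub of every other line):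

**ε-negative GL₂-CAP classes (m = 1, p = 4).** Let `ψ = ρ ⊠ R₂ ⊞ χ₀` be an Arthur parameter of
`U(V)`, `dim_E V = 5`, with `ρ` a conjugate-symplectic cuspidal representation of `GL₂(𝔸_E)` of
`τ`-type `(z/z̄)^{±3/2}` at every complex place and `χ₀` a conjugate-orthogonal character of finite
order. At `τ₁` the Adams–Johnson packet of `ψ` contains the discrete series `A(2,2)`; at the compact
real places it is `{𝟙}`; so `H⁴` of the `ψ`-isotypic part is PURE of type `(2,2)` for every
automorphic member and for every `Aut(ℂ)`-conjugate of `π_f` (`σχ₀` is again of finite order), i.e.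
the `ℚ`-Hecke-isotypic piece `N ⊂ H⁴(X_K; ℚ)` consists of RATIONAL Hodge `(2,2)`-classes.
(1) ONLY SOURCE: a theta lift to `U(V₅)` from `U(W_k)` has parameter `(φ ⊗ χ_V⁻¹χ_W) ⊞ χ_W ⊠ R_{5-k}`
(Gan–Ichino, arXiv:1409.6824 Thm 4.4), so `R₂` on a 2-dimensional `ρ` arises only from `k = 4`.
(2) MULTIPLICITY: Arthur's sign character is `ε_ψ(s_ψ) = ε(½, ρ × χ₀⁻¹)`; with `ρ_{v₀}` discrete series
at one non-split place the local packet at `v₀` is `{J, δ}` and both parities of `#δ`-places occur, so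
for `ε(½, ρ × χ₀⁻¹) = -1` the automorphic members with `Π_∞ = A(2,2) ⊗ 𝟙^{d-1}` are exactly those with
an ODD number of `δ`-places (Mok 2014 / Kaletha–Mínguez–Shin–White for the inner form).
(3) DICHOTOMY: each `Π_v` is a local theta lift from exactly one 4-dimensional hermitian `W_v^{±}`
(Gan–Ichino (P2), conservation relation), `δ ↔ W⁻`, `J ↔ W⁺`; an odd number of `δ`-places is an
INCOHERENT collection `{W_v}`, so `Π` is a theta lift from NO global `W₄`, split or not.
(4) ORTHOGONALITY: `SC²` consists of Fourier coefficients of the Kudla–Millson kernel for the split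
`W₄`, every `(1,1)`-class is `L` or a theta lift from a 2-dimensional `W₂` (BMM, `p ≥ 3`), a product of
two such is a value of the kernel for `U(W₂ ⊕ W₂')` (BMM (diffcup)), and `L · H²` misses the
primitive `A(2,2)`-part; hence the Hecke projector `e` onto `M[Π_f]` kills `SC²(D)` and EVERY cup
product of two degree-2 classes, while `e c = c ≠ 0` for `c ∈ N_ℚ` — which is `EpsNegativeCapWitness`.
Why BMM never meet it: in their range Prop. 80 forces `μ ⊠ R_b` with `μ` a CHARACTER; at `a = 1` (this
crux) the companion value is the CENTRAL value `L(½, ρ × χ₀⁻¹)`, and the `a = 1` case of BMM Thm 72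
is false for GL₂-CAP input. This is the `p = 4`, middle-degree analogue of the Blasius–Rogawski
classes on Picard modular surfaces (`p = 2`: rational `(1,1)`-classes in ε-negative endoscopic packets,
algebraic only by Lefschetz (1,1), never special).
HYPOTHESES of the discharge (all in the framework BMM already assume; none constructible in the tree):
the Arthur–Mok–KMSW multiplicity formula for the NON-generic `ψ` on the inner form `U(V)`
(archimedean packets = Adams–Johnson), Mœglin's two-element local packet at `v₀`, Gan–Ichino
Thm 4.4/(P2), BMM's theta description of `SC²` and `H^{1,1}` (`p ≥ 3`), existence of `(ρ, χ₀)` with a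
discrete-series place and `ε(½, ρ × χ₀⁻¹) = -1`.

Consequences recorded for the planner: the witness also misses the repaired statements `C′`
(`MiddleThetaSpanWidened`) and `C″` (`MiddleThetaSpanOnSpecial`) of the Disproof and every theta
rendering; a repaired crux must EXCLUDE the ε-negative GL₂-CAP pieces (and then `MiddleDegreeStep` needs
a cycle construction there — "higher Blasius–Rogawski classes" already at `p = 4`, not `p = 5` as item
stmt-HodgeConjecture-13662 bets), or restrict to `m = 2` after the analogous `p = 6` audit.

## References

* [BergeronMillsonMoeglin2016Balls] N. Bergeron, J. Millson, C. Moeglin, arXiv:1306.1515, Thm 4,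
  Rem. after Cor. 62, Thm 71–72, Prop. 80, (diffcup) p. 40.
* [GanIchino2014] W. T. Gan, A. Ichino, arXiv:1409.6824, Thm 4.4 and (P2).
* [Mok2014] C. P. Mok, Mem. AMS 235 (2014); [KalethaMinguezShinWhite2014] arXiv:1409.3731.
* [BlasiusRogawski1993] D. Blasius, J. Rogawski (the `p = 2` precedent: Tate classes on the two-ball).
* [KudlaMillson1990] S. Kudla, J. Millson, Publ. IHÉS 71 (1990).
-/

noncomputable section

-- The mandated namespace `Summit.<P>.<Sub>.…` repeats `HodgeConjecture` (single-conjunct summit).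
set_option linter.dupNamespace false

namespace Summit.HodgeConjecture.HodgeConjecture.Theorems.MiddleThetaSpan.Negative

open Literature.AlgebraicGeometry Literature.AlgebraicGeometry.HodgeTheory
  Literature.AlgebraicGeometry.ShimuraVarieties Literature.AlgebraicTopology.SingularHomology
open Summit.HodgeConjecture.HodgeConjecture.Theses.EndoscopicMiddleDegree (MiddleThetaSpan)

/-- **The ε-negative GL₂-CAP witness shape (hypothesis `H` of the negative lemma; NOT constructible
in the tree today).** Some compact arithmetic 4-ball quotient `X` (datum `D : UnitaryBallQuotientDatum 4 X`,
written `2 * (1 + 1)` to match the crux at `m = 1`) carries a `ℂ`-linear endomorphism `e` of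
`H⁴(X(ℂ); ℂ)` which (i) annihilates every class supported on a special 2-cycle `c(W)`, `dim_E W = 2`
(so `SC²(D) ≤ ker e`), (ii) annihilates EVERY cup product of two degree-2 classes, and (iii) does not
annihilate some RATIONAL class of Hodge type `(2,2)`. Intended instance (module docstring): `e` = the
Hecke projector onto the `ℚ`-isotypic piece of an ε-negative GL₂-CAP parameter `ρ ⊠ R₂ ⊞ χ₀`
(`ε(½, ρ × χ₀⁻¹) = -1`), whose automorphic members with `A(2,2)` at `τ₁` are theta lifts from no
4-dimensional hermitian space, hence cup-orthogonal to all theta-generated classes, while the piece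
consists of rational Tate `(2,2)`-classes. Strictly STRONGER than `¬ MiddleThetaSpan` (it kills all of
`H² ∪ H²`, not only products with divisor classes), so it is not a restatement of the crux.
[cite: GanIchino2014, Thm 4.4] [cite: BergeronMillsonMoeglin2016Balls, Introduction Thm 4 and Part 2 Thm 72] -/
def EpsNegativeCapWitness : Prop :=
  ∃ (X : Motives.SchemeOver ℂ) (D : UnitaryBallQuotientDatum (2 * (1 + 1)) X)
    (e : complexBetti X (2 * (1 + 1)) →ₗ[ℂ] complexBetti X (2 * (1 + 1))),
    (⨆ (W : Submodule D.E (Fin (2 * (1 + 1) + 1) → D.E))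
        (_ : IsTotallyPositive (conjRingHom D.E) D.H W) (_ : Module.finrank D.E W = 1 + 1),
        classesSupportedOn X (D.specialSubvariety W) (2 * (1 + 1))) ≤ LinearMap.ker e ∧
    (∀ s d : complexBetti X (2 * 1), e (cupProduct (two_mul_add_two_mul 1 1) s d) = 0) ∧
    ∃ c : complexBetti X (2 * (1 + 1)), IsRationalClass c ∧
      IsOfHodgeType (2 * (1 + 1)) X (2 * (1 + 1)) (1 + 1) (1 + 1) c ∧ e c ≠ 0

/-- **Negative lemma: `EpsNegativeCapWitness → ¬ MiddleThetaSpan`.** At `m = 1` the crux puts the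
rational `(2,2)`-class `c` of the witness into `SC²(D) ⊔ span{s ∪ d} ⊔ span{a ∪ d}` with `s, a, d` of
degree 2; the endomorphism `e` of the witness kills all three summands ((i) for the first, (ii) for the
two product summands), contradicting `e c ≠ 0`. The mathematics (why such a witness exists on genuine
compact `U(4,1)`-quotients, conditionally on the Arthur–Mok–KMSW multiplicity formula for non-generic
parameters) is in the docstring of `EpsNegativeCapWitness` and the module docstring.
[cite: BergeronMillsonMoeglin2016Balls, Introduction Thm 4] -/
theorem MiddleThetaSpan_false_of_epsNegativeCapWitness (hW : EpsNegativeCapWitness) :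
    ¬ MiddleThetaSpan := by
  rintro h
  obtain ⟨X, D, e, hSC, hcup, c, hc, hcH, hce⟩ := hW
  have hmem := h 1 X D le_rfl (by norm_num) c hc hcH
  have hker : (⨆ (W : Submodule D.E (Fin (2 * (1 + 1) + 1) → D.E))
        (_ : IsTotallyPositive (conjRingHom D.E) D.H W) (_ : Module.finrank D.E W = 1 + 1),
        classesSupportedOn X (D.specialSubvariety W) (2 * (1 + 1))) ⊔
      Submodule.span ℂ {z : complexBetti X (2 * (1 + 1)) |
        ∃ s ∈ (⨆ (W : Submodule D.E (Fin (2 * (1 + 1) + 1) → D.E))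
          (_ : IsTotallyPositive (conjRingHom D.E) D.H W) (_ : Module.finrank D.E W = 1),
          classesSupportedOn X (D.specialSubvariety W) (2 * 1)),
          ∃ d ∈ algebraicClasses X 1, z = cupProduct (two_mul_add_two_mul 1 1) s d} ⊔
      Submodule.span ℂ {z : complexBetti X (2 * (1 + 1)) |
        ∃ a : complexBetti X (2 * 1), IsRationalClass a ∧
          IsOfHodgeType (2 * (1 + 1)) X (2 * 1) 1 1 a ∧
            ∃ d ∈ algebraicClasses X 1, z = cupProduct (two_mul_add_two_mul 1 1) a d} ≤
      LinearMap.ker e := by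
    refine sup_le (sup_le hSC ?_) ?_
    · refine Submodule.span_le.2 ?_
      rintro z ⟨s, -, d, -, rfl⟩
      exact LinearMap.mem_ker.2 (hcup s d)
    · refine Submodule.span_le.2 ?_
      rintro z ⟨a, -, -, d, -, rfl⟩
      exact LinearMap.mem_ker.2 (hcup a d)
  exact hce (LinearMap.mem_ker.1 (hker hmem))

end Summit.HodgeConjecture.HodgeConjecture.Theorems.MiddleThetaSpan.Negative

end
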